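import Mathlib.MeasureTheory.Integral.IntervalIntegral.FundThmCalculus
import Mathlib.MeasureTheory.Integral.DominatedConvergence
import Literature.Analysis.PDE.HopfMinimumPrinciple
import Literature.Geometry.Lorentzian.MinimalSurfaceTangency
import HarnessLib

/-!
# Alexandrov's maximum principle for elliptic jet operators (Fontenele–Silva 2001, §2)
(family `gr`, in support of **gr.S09**; namespace `Literature.Geometry.Lorentzian`)

Library fit. `MinimalSurfaceTangency.lean` reduces the live named fact
`minimalGraph_strongMaximumPrinciple` (Andersson–Galloway–Howard 1998, Thm. 3.10, the input of
`minimalSurface_barrierPrinciple_of_graph` and hence of the barrier principle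
`minimalSurface_barrierPrinciple`, the boundary maximum principle and the connected-horizon
Riemannian Penrose inequality) to two analytic inputs taken there as hypotheses: (2) a
minimal-graph operator `MinimalGraphOperator h ψ T` in every chart and (3) the tangency maximum
principle `HasTangencyMaximumPrinciple G.Φ (chartJetSet ψ T)` for it. This file **proves (3)**
for every `C¹` function on an open set of jets — Alexandrov's maximum principle as printed in
Fontenele–Silva, Illinois J. Math. 45 (2001), §2, pp. 216–217 — from E. Hopf's minimum principle
(`Literature.Analysis.PDE.hopf_minimumPrinciple_eventually_eq`, López-Gómez 2012, Thm. 1.2):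

* `jet_eq_sum_coord`, `clm_jet_apply_eq_sum`, `clm_quadJet_eq_sum` — a linear functional on
  jets evaluated on a jet with base point `0`, resp. on the quadratic jet `(ξᵢξⱼ, 0, 0, 0)` of
  the ellipticity condition (2.1), in terms of its values on the coordinate jets;
* `jet2_fst_eq`, `jet2_linearComb_fst`, `jet2_segment`, `jet2_sub_eq`, `continuousOn_jet2` — the
  jets `Λ(f)(x)` (2.2) of `C²` functions on an open set: the Hessian slot is the second Fréchet
  derivative `D(Df)(x) eᵢ eⱼ`, jets of linear combinations, of the segment `(1 - t) f + t g` and of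
  the difference `g - f`, continuity in `x`;
* `sub_eq_integral_fderiv_jetSegment` — **the linearisation**
  `Φ(Λg) - Φ(Λf) = (∫₀¹ DΦ(Λf + t(Λg - Λf)) dt)(Λg - Λf)` (fundamental theorem of calculus);
  `continuousOn_integral_fderiv_jetSegment` — the averaged derivative is continuous in `x`;
* `hasTangencyMaximumPrinciple_of_contDiffOn` — **the Maximum Principle of §2**:
  `IsOpen Γ → ContDiffOn ℝ 1 Φ Γ → HasTangencyMaximumPrinciple Φ Γ`;
* `minimalGraph_strongMaximumPrinciple_of_minimalGraphOperator`,
  `minimalSurface_barrierPrinciple_of_minimalGraphOperator`,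
  `riemannian_penrose_inequality_connected_smooth_of_minimalGraphOperator` — the chain of
  `MinimalSurfaceTangency.lean` with input (3) discharged: only the minimal-graph operators
  (step (2), Fontenele–Silva Lemma 3.1 and Props. 3.2, 3.4 for the chart `T ∘ ψ`) remain.

Proof of the Maximum Principle (as printed, p. 217: "one linearizes in a well-known fashion,
`Φ(Λ(f)(x)) - Φ(Λ(g)(x)) = L(f - g)(x) ≥ 0`, and then applies Hopf's maximum principle for linear
operators"). With `w = g - f ≥ 0` and `A(x) = ∫₀¹ DΦ(Λf(x) + t(Λg(x) - Λf(x))) dt`,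
`0 ≥ Φ(Λg) - Φ(Λf) = A(x)(Λg - Λf) = ∑ aᵢⱼ ∂ᵢⱼw + ∑ bᵢ ∂ᵢw + c w` with `aᵢⱼ(x) = A(x)(δᵢδⱼ)`,
`bᵢ(x) = A(x)(δᵢ)`, `c(x) = A(x)(1)` continuous on `U` and `∑ aᵢⱼ ξᵢ ξⱼ = ∫₀¹ DΦ(…)(ξξᵀ) dt > 0`
for `ξ ≠ 0` by ellipticity along the segment. On a closed ball `B̄_r(x₀) ⊆ U` the coefficients
are bounded and `(aᵢⱼ)` is uniformly elliptic (compactness of `B̄_r(x₀) × 𝕊ⁿ⁻¹`); with the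
symmetrised `ãᵢⱼ = (aᵢⱼ + aⱼᵢ)/2` (the Hessian of `w` is symmetric) the operator
`𝔏 = -∑ ãᵢⱼ ∂ᵢⱼ - ∑ bᵢ ∂ᵢ + c⁻`, `c⁻ = max(-c, 0) ≥ 0`, has `𝔏w = -(Φ(Λg) - Φ(Λf)) + c⁺ w ≥ 0`
on `B_r(x₀)`, `w ≥ 0 = w(x₀)`, so `w = 0` near `x₀` by E. Hopf's minimum principle.

Faithfulness. The hypotheses are those printed in Fontenele–Silva, §2: `Φ` of class `C¹` on an
open set `Γ` of jets (all `n²` Hessian entries are kept, as in `Jet`; see `IsEllipticAt`), `f, g`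
of class `C²` on an open `U`, `Φ` elliptic with respect to `(1 - t) f + t g`, `t ∈ [0, 1]`,
(2.3) and `f ≤ g`; the conclusion is the coincidence of `f` and `g` near every touching point,
which is `HasTangencyMaximumPrinciple`.

## References

* F. Fontenele, S. L. Silva, *A tangency principle and applications*, Illinois J. Math. 45
  (2001) 213–228: §2, (2.1)–(2.3) and the Maximum Principle, pp. 216–217.
* A. D. Alexandrov, *Uniqueness theorems for surfaces in the large. I*, Amer. Math. Soc.
  Transl. (2) 21 (1962) 341–354 (reference [1] of Fontenele–Silva).
* J. López-Gómez, *Linear Second Order Elliptic Operators*, World Scientific (2012), Thm. 1.2.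
* L. Andersson, G. J. Galloway, R. Howard, Comm. Pure Appl. Math. 51 (1998) 581–624, Thm. 2.4
  (the `C²` case) and Thm. 3.10.
-/

noncomputable section

open Bundle Set Filter Function Metric MeasureTheory intervalIntegral
open scoped Topology Manifold ContDiff

namespace Literature.Geometry.Lorentzian

open Literature.Analysis.PDE PseudoRiemannianMetric

variable {n : ℕ}

/-! ### Linear algebra of jets -/

/-- Decomposition of a jet `(r, q, z, x)` along the coordinate jets `(δᵢδⱼ, 0, 0, 0)`,
`(0, δᵢ, 0, 0)`, `(0, 0, 1, 0)` and the base-point jet `(0, 0, 0, x)`. [folklore] -/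
theorem jet_eq_sum_coord (D : Jet n) :
    D = (∑ i, ∑ j, D.1 i j •
        ((Pi.single i (Pi.single j (1 : ℝ)) : Fin n → Fin n → ℝ), (0 : Fin n → ℝ), (0 : ℝ),
          (0 : EuclideanSpace ℝ (Fin n)))) +
      (∑ i, D.2.1 i • ((0 : Fin n → Fin n → ℝ), (Pi.single i (1 : ℝ) : Fin n → ℝ), (0 : ℝ),
          (0 : EuclideanSpace ℝ (Fin n)))) +
      D.2.2.1 • ((0 : Fin n → Fin n → ℝ), (0 : Fin n → ℝ), (1 : ℝ),
        (0 : EuclideanSpace ℝ (Fin n))) +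
      ((0 : Fin n → Fin n → ℝ), (0 : Fin n → ℝ), (0 : ℝ), D.2.2.2) := by
  obtain ⟨M, q, s, y⟩ := D
  ext k l
  · simp [Prod.fst_sum, Finset.sum_apply, Pi.single_apply]
  · simp [Prod.fst_sum, Prod.snd_sum, Finset.sum_apply, Pi.single_apply]
  · simp [Prod.snd_sum]
  · simp [Prod.snd_sum]

/-- A linear functional on jets, evaluated on a jet `D` with base point `0`, is the combination
`∑ᵢⱼ Dᵢⱼ L(δᵢδⱼ) + ∑ᵢ Dᵢ L(δᵢ) + D_z L(1)` of its values on the coordinate jets. [folklore] -/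
theorem clm_jet_apply_eq_sum (L : Jet n →L[ℝ] ℝ) (D : Jet n) (hD : D.2.2.2 = 0) :
    L D = ∑ i, ∑ j, D.1 i j *
        L ((Pi.single i (Pi.single j (1 : ℝ)) : Fin n → Fin n → ℝ), (0 : Fin n → ℝ), (0 : ℝ),
          (0 : EuclideanSpace ℝ (Fin n))) +
      ∑ i, D.2.1 i * L ((0 : Fin n → Fin n → ℝ), (Pi.single i (1 : ℝ) : Fin n → ℝ), (0 : ℝ),
          (0 : EuclideanSpace ℝ (Fin n))) +
      D.2.2.1 * L ((0 : Fin n → Fin n → ℝ), (0 : Fin n → ℝ), (1 : ℝ),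
        (0 : EuclideanSpace ℝ (Fin n))) := by
  conv_lhs => rw [jet_eq_sum_coord D, hD]
  have h0 : ((0 : Fin n → Fin n → ℝ), (0 : Fin n → ℝ), (0 : ℝ), (0 : EuclideanSpace ℝ (Fin n))) =
      (0 : Jet n) := rfl
  simp only [map_add, map_sum, map_smul, smul_eq_mul, h0, add_zero]

/-- The quadratic jet `(ξᵢξⱼ, 0, 0, 0)` of the ellipticity condition is the combination
`∑ᵢⱼ ξᵢ ξⱼ (δᵢδⱼ, 0, 0, 0)`; hence `L` of it is `∑ᵢⱼ L(δᵢδⱼ) ξᵢ ξⱼ`. [folklore] -/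
theorem clm_quadJet_eq_sum (L : Jet n →L[ℝ] ℝ) (ξ : Fin n → ℝ) :
    L ((fun i j ↦ ξ i * ξ j), 0, 0, 0) = ∑ i, ∑ j,
      L ((Pi.single i (Pi.single j (1 : ℝ)) : Fin n → Fin n → ℝ), (0 : Fin n → ℝ), (0 : ℝ),
          (0 : EuclideanSpace ℝ (Fin n))) * ξ i * ξ j := by
  rw [clm_jet_apply_eq_sum L _ rfl]
  simp only [Pi.zero_apply, zero_mul, Finset.sum_const_zero, add_zero]
  refine Finset.sum_congr rfl fun i _ ↦ Finset.sum_congr rfl fun j _ ↦ ?_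
  ring

/-! ### Second-order jets of `C²` functions -/

section JetCalculus

variable {U : Set (EuclideanSpace ℝ (Fin n))} {f g : EuclideanSpace ℝ (Fin n) → ℝ}
  {x : EuclideanSpace ℝ (Fin n)}

/-- A `C²` function on an open set is differentiable at its points. [folklore] -/
lemma differentiableAt_of_contDiffOn_two (hU : IsOpen U) (hf : ContDiffOn ℝ 2 f U) (hx : x ∈ U) :
    DifferentiableAt ℝ f x :=
  (hf.contDiffAt (hU.mem_nhds hx)).differentiableAt two_ne_zero

/-- The derivative of a `C²` function on an open set is differentiable at its points.
[folklore] -/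
lemma differentiableAt_fderiv_of_contDiffOn_two (hU : IsOpen U) (hf : ContDiffOn ℝ 2 f U)
    (hx : x ∈ U) : DifferentiableAt ℝ (fderiv ℝ f) x :=
  ((hf.fderiv_of_isOpen hU le_rfl).contDiffAt (hU.mem_nhds hx)).differentiableAt one_ne_zero

/-- For a `C²` function on an open set, the Hessian slot of `Λ(f)(x)` (the derivative along `eᵢ`
of the partial derivative `∂ⱼf`) is the second Fréchet derivative `D(Df)(x) eᵢ eⱼ`.
[folklore] -/
theorem jet2_fst_eq (hU : IsOpen U) (hf : ContDiffOn ℝ 2 f U) (hx : x ∈ U) (i j : Fin n) :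
    (jet2 f x).1 i j = fderiv ℝ (fderiv ℝ f) x (EuclideanSpace.single i 1)
      (EuclideanSpace.single j 1) := by
  simp only [jet2]
  rw [fderiv_clm_apply (differentiableAt_fderiv_of_contDiffOn_two hU hf hx)
    (differentiableAt_const _)]
  simp

/-- The gradient slot of `Λ(f)(x)` is `Df(x) eᵢ`. [folklore] -/
@[simp] theorem jet2_snd_fst (f : EuclideanSpace ℝ (Fin n) → ℝ) (x : EuclideanSpace ℝ (Fin n))
    (i : Fin n) : (jet2 f x).2.1 i = fderiv ℝ f x (EuclideanSpace.single i 1) := rfl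

/-- The value slot of `Λ(f)(x)` is `f x`. [folklore] -/
@[simp] theorem jet2_snd_snd_fst (f : EuclideanSpace ℝ (Fin n) → ℝ) (x : EuclideanSpace ℝ (Fin n)) :
    (jet2 f x).2.2.1 = f x := rfl

/-- The base-point slot of `Λ(f)(x)` is `x`. [folklore] -/
@[simp] theorem jet2_snd_snd_snd (f : EuclideanSpace ℝ (Fin n) → ℝ) (x : EuclideanSpace ℝ (Fin n)) :
    (jet2 f x).2.2.2 = x := rfl

/-- First derivative of a linear combination of `C²` functions at a point of the open set.
[folklore] -/
theorem fderiv_linearComb (hU : IsOpen U) (hf : ContDiffOn ℝ 2 f U) (hg : ContDiffOn ℝ 2 g U)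
    (hx : x ∈ U) (α β : ℝ) :
    fderiv ℝ (α • f + β • g) x = α • fderiv ℝ f x + β • fderiv ℝ g x :=
  (((differentiableAt_of_contDiffOn_two hU hf hx).hasFDerivAt.const_smul α).add
    ((differentiableAt_of_contDiffOn_two hU hg hx).hasFDerivAt.const_smul β)).fderiv

/-- Second derivative of a linear combination of `C²` functions at a point of the open set.
[folklore] -/
theorem fderiv_fderiv_linearComb (hU : IsOpen U) (hf : ContDiffOn ℝ 2 f U)
    (hg : ContDiffOn ℝ 2 g U) (hx : x ∈ U) (α β : ℝ) :
    fderiv ℝ (fderiv ℝ (α • f + β • g)) x =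
      α • fderiv ℝ (fderiv ℝ f) x + β • fderiv ℝ (fderiv ℝ g) x := by
  have hev : fderiv ℝ (α • f + β • g) =ᶠ[𝓝 x] fun y ↦ α • fderiv ℝ f y + β • fderiv ℝ g y :=
    Filter.eventually_of_mem (hU.mem_nhds hx) fun y hy ↦ fderiv_linearComb hU hf hg hy α β
  rw [hev.fderiv_eq]
  exact (((differentiableAt_fderiv_of_contDiffOn_two hU hf hx).hasFDerivAt.const_smul α).add
    ((differentiableAt_fderiv_of_contDiffOn_two hU hg hx).hasFDerivAt.const_smul β)).fderiv

/-- A linear combination of `C²` functions is `C²`. [folklore] -/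
lemma contDiffOn_linearComb (hf : ContDiffOn ℝ 2 f U) (hg : ContDiffOn ℝ 2 g U) (α β : ℝ) :
    ContDiffOn ℝ 2 (α • f + β • g) U :=
  (contDiffOn_const.smul hf).add (contDiffOn_const.smul hg)

/-- **Jets of linear combinations.** For `C²` functions `f, g` on an open `U` and `x ∈ U`, the
Hessian slot of `Λ(αf + βg)(x)` is `α` times that of `Λ(f)(x)` plus `β` times that of `Λ(g)(x)`.
[folklore] -/
theorem jet2_linearComb_fst (hU : IsOpen U) (hf : ContDiffOn ℝ 2 f U) (hg : ContDiffOn ℝ 2 g U)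
    (hx : x ∈ U) (α β : ℝ) :
    (jet2 (α • f + β • g) x).1 = α • (jet2 f x).1 + β • (jet2 g x).1 := by
  ext i j
  rw [jet2_fst_eq hU (contDiffOn_linearComb hf hg α β) hx, fderiv_fderiv_linearComb hU hf hg hx]
  simp [jet2_fst_eq hU hf hx, jet2_fst_eq hU hg hx]

/-- The gradient slot of `Λ(αf + βg)(x)`. [folklore] -/
theorem jet2_linearComb_snd_fst (hU : IsOpen U) (hf : ContDiffOn ℝ 2 f U)
    (hg : ContDiffOn ℝ 2 g U) (hx : x ∈ U) (α β : ℝ) :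
    (jet2 (α • f + β • g) x).2.1 = α • (jet2 f x).2.1 + β • (jet2 g x).2.1 := by
  ext i
  simp [fderiv_linearComb hU hf hg hx]

/-- **Jets of the segment.** For `x ∈ U` and any `t`,
`Λ((1 - t) f + t g)(x) = Λ(f)(x) + t (Λ(g)(x) - Λ(f)(x))` (the base points agree).
[cite: FonteneleSilva2001, §2 (proof of the Maximum Principle)] -/
theorem jet2_segment (hU : IsOpen U) (hf : ContDiffOn ℝ 2 f U) (hg : ContDiffOn ℝ 2 g U)
    (hx : x ∈ U) (t : ℝ) :
    jet2 ((1 - t) • f + t • g) x = jet2 f x + t • (jet2 g x - jet2 f x) := by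
  ext i j
  · rw [jet2_linearComb_fst hU hf hg hx]
    simp only [Pi.add_apply, Pi.smul_apply, smul_eq_mul, Prod.fst_add, Prod.smul_fst,
      Prod.fst_sub, Pi.sub_apply]
    ring
  · rw [jet2_linearComb_snd_fst hU hf hg hx]
    simp only [Pi.add_apply, Pi.smul_apply, smul_eq_mul, Prod.snd_add, Prod.smul_snd,
      Prod.fst_add, Prod.smul_fst, Prod.snd_sub, Prod.fst_sub, Pi.sub_apply]
    ring
  · simp only [jet2_snd_snd_fst, Pi.add_apply, Pi.smul_apply, smul_eq_mul, Prod.snd_add,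
      Prod.smul_snd, Prod.fst_add, Prod.smul_fst, Prod.snd_sub, Prod.fst_sub]
    ring
  · simp [jet2_snd_snd_snd]

/-- The difference `w = g - f` of two `C²` functions: its second derivatives, first derivatives
and values at `x ∈ U` are the first three slots of `Λ(g)(x) - Λ(f)(x)`. [folklore] -/
theorem jet2_sub_eq (hU : IsOpen U) (hf : ContDiffOn ℝ 2 f U) (hg : ContDiffOn ℝ 2 g U)
    (hx : x ∈ U) (i j : Fin n) :
    (jet2 g x - jet2 f x).1 i j = fderiv ℝ (fderiv ℝ (fun y ↦ g y - f y)) x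
        (EuclideanSpace.single i 1) (EuclideanSpace.single j 1) ∧
    (jet2 g x - jet2 f x).2.1 i = fderiv ℝ (fun y ↦ g y - f y) x (EuclideanSpace.single i 1) ∧
    (jet2 g x - jet2 f x).2.2.1 = g x - f x := by
  have hfun : (fun y ↦ g y - f y) = (-1 : ℝ) • f + (1 : ℝ) • g := by
    ext y; simp; ring
  refine ⟨?_, ?_, ?_⟩
  · rw [hfun, fderiv_fderiv_linearComb hU hf hg hx]
    simp [jet2_fst_eq hU hf hx, jet2_fst_eq hU hg hx]
    ring
  · rw [hfun, fderiv_linearComb hU hf hg hx]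
    simp
    ring
  · simp

/-- The jet map `x ↦ Λ(f)(x)` of a `C²` function is continuous on the open set `U`.
[folklore] -/
theorem continuousOn_jet2 (hU : IsOpen U) (hf : ContDiffOn ℝ 2 f U) : ContinuousOn (jet2 f) U := by
  have h2 : ContinuousOn (fderiv ℝ (fderiv ℝ f)) U :=
    ((hf.fderiv_of_isOpen hU (m := 1) le_rfl).fderiv_of_isOpen hU (m := 0)
      (by norm_num)).continuousOn
  have h1 : ContinuousOn (fderiv ℝ f) U := (hf.fderiv_of_isOpen hU (m := 1) le_rfl).continuousOn
  refine ContinuousOn.prodMk ?_ (ContinuousOn.prodMk ?_ (ContinuousOn.prodMk hf.continuousOn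
    continuousOn_id))
  · refine continuousOn_pi.mpr fun i ↦ continuousOn_pi.mpr fun j ↦ ?_
    have : ContinuousOn (fun x ↦ fderiv ℝ (fderiv ℝ f) x (EuclideanSpace.single i 1)
        (EuclideanSpace.single j 1)) U :=
      ((h2.clm_apply continuousOn_const).clm_apply continuousOn_const)
    exact this.congr fun x hx ↦ jet2_fst_eq hU hf hx i j
  · exact continuousOn_pi.mpr fun i ↦ h1.clm_apply continuousOn_const

end JetCalculus

/-! ### Linearisation along the segment of jets -/

section Linearisation

variable {Φ : Jet n → ℝ} {Γ : Set (Jet n)} {U : Set (EuclideanSpace ℝ (Fin n))}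
  {f g : EuclideanSpace ℝ (Fin n) → ℝ} {x : EuclideanSpace ℝ (Fin n)}

/-- Along the segment `t ↦ Λ(f)(x) + t (Λ(g)(x) - Λ(f)(x))`, `t ∈ [0, 1]`, whose points are the
jets of `(1 - t) f + t g` and lie in `Γ`, the derivative `DΦ` of the `C¹` function `Φ` is
continuous. [folklore] -/
theorem continuousOn_fderiv_comp_jetSegment (hΓ : IsOpen Γ) (hΦ : ContDiffOn ℝ 1 Φ Γ)
    (hU : IsOpen U) (hf : ContDiffOn ℝ 2 f U) (hg : ContDiffOn ℝ 2 g U) (hx : x ∈ U)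
    (hseg : ∀ t ∈ Icc (0 : ℝ) 1, jet2 ((1 - t) • f + t • g) x ∈ Γ) :
    ContinuousOn (fun t : ℝ ↦ fderiv ℝ Φ (jet2 f x + t • (jet2 g x - jet2 f x))) (Icc 0 1) := by
  refine (hΦ.continuousOn_fderiv_of_isOpen hΓ le_rfl).comp (by fun_prop) fun t ht ↦ ?_
  rw [← jet2_segment hU hf hg hx]
  exact hseg t ht

/-- The derivative `DΦ` along the segment is interval integrable on `[0, 1]`. [folklore] -/
theorem intervalIntegrable_fderiv_comp_jetSegment (hΓ : IsOpen Γ) (hΦ : ContDiffOn ℝ 1 Φ Γ)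
    (hU : IsOpen U) (hf : ContDiffOn ℝ 2 f U) (hg : ContDiffOn ℝ 2 g U) (hx : x ∈ U)
    (hseg : ∀ t ∈ Icc (0 : ℝ) 1, jet2 ((1 - t) • f + t • g) x ∈ Γ) :
    IntervalIntegrable (fun t : ℝ ↦ fderiv ℝ Φ (jet2 f x + t • (jet2 g x - jet2 f x)))
      volume 0 1 := by
  refine ContinuousOn.intervalIntegrable ?_
  rw [uIcc_of_le zero_le_one]
  exact continuousOn_fderiv_comp_jetSegment hΓ hΦ hU hf hg hx hseg

/-- **Linearisation** (Fontenele–Silva 2001, §2, proof of the Maximum Principle; the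
fundamental theorem of calculus along the segment of jets):
`Φ(Λg(x)) - Φ(Λf(x)) = (∫₀¹ DΦ(Λf(x) + t(Λg(x) - Λf(x))) dt) (Λg(x) - Λf(x))`.
[cite: FonteneleSilva2001, §2 (proof of the Maximum Principle)] -/
theorem sub_eq_integral_fderiv_jetSegment (hΓ : IsOpen Γ) (hΦ : ContDiffOn ℝ 1 Φ Γ)
    (hU : IsOpen U) (hf : ContDiffOn ℝ 2 f U) (hg : ContDiffOn ℝ 2 g U) (hx : x ∈ U)
    (hseg : ∀ t ∈ Icc (0 : ℝ) 1, jet2 ((1 - t) • f + t • g) x ∈ Γ) :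
    Φ (jet2 g x) - Φ (jet2 f x) =
      (∫ t in (0 : ℝ)..1, fderiv ℝ Φ (jet2 f x + t • (jet2 g x - jet2 f x)))
        (jet2 g x - jet2 f x) := by
  set D : Jet n := jet2 g x - jet2 f x with hD
  set J : ℝ → Jet n := fun t ↦ jet2 f x + t • D with hJ
  rw [ContinuousLinearMap.intervalIntegral_apply
    (intervalIntegrable_fderiv_comp_jetSegment hΓ hΦ hU hf hg hx hseg) D]
  have hJd : ∀ t, HasDerivAt J D t := fun t ↦ by
    have := ((hasDerivAt_id t).smul_const D).const_add (jet2 f x)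
    simpa [hJ] using this
  have hderiv : ∀ t ∈ uIcc (0 : ℝ) 1, HasDerivAt (Φ ∘ J) (fderiv ℝ Φ (J t) D) t := by
    intro t ht
    rw [uIcc_of_le zero_le_one] at ht
    have hJt : J t ∈ Γ := by
      have := hseg t ht
      rwa [jet2_segment hU hf hg hx] at this
    have hΦd : DifferentiableAt ℝ Φ (J t) :=
      (hΦ.differentiableOn one_ne_zero _ hJt).differentiableAt (hΓ.mem_nhds hJt)
    exact hΦd.hasFDerivAt.comp_hasDerivAt t (hJd t)
  have hcont : ContinuousOn (fun t ↦ fderiv ℝ Φ (J t) D) (uIcc (0 : ℝ) 1) := by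
    rw [uIcc_of_le zero_le_one]
    exact (continuousOn_fderiv_comp_jetSegment hΓ hΦ hU hf hg hx hseg).clm_apply
      continuousOn_const
  have hftc := integral_eq_sub_of_hasDerivAt hderiv hcont.intervalIntegrable
  have h1 : J 1 = jet2 g x := by simp [hJ, hD]
  have h0 : J 0 = jet2 f x := by simp [hJ]
  change Φ (jet2 g x) - Φ (jet2 f x) = ∫ t in (0 : ℝ)..1, fderiv ℝ Φ (J t) D
  rw [hftc]
  simp [h1, h0]

/-- **Continuity of the averaged derivative.** If the jets of `(1 - t) f + t g`, `t ∈ [0, 1]`,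
lie in `Γ` at every point of the open set `U`, then
`x ↦ ∫₀¹ DΦ(Λf(x) + t(Λg(x) - Λf(x))) dt` is continuous on `U` (a parametric integral of a
continuous function on `U × [0, 1]`; the jets of `C²` functions depend continuously on the
point). [folklore] -/
theorem continuousOn_integral_fderiv_jetSegment (hΓ : IsOpen Γ) (hΦ : ContDiffOn ℝ 1 Φ Γ)
    (hU : IsOpen U) (hf : ContDiffOn ℝ 2 f U) (hg : ContDiffOn ℝ 2 g U)
    (hseg : ∀ t ∈ Icc (0 : ℝ) 1, ∀ x ∈ U, jet2 ((1 - t) • f + t • g) x ∈ Γ) :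
    ContinuousOn (fun x ↦ ∫ t in (0 : ℝ)..1,
      fderiv ℝ Φ (jet2 f x + t • (jet2 g x - jet2 f x))) U := by
  rw [continuousOn_iff_continuous_restrict]
  have hJf : Continuous fun p : U ↦ jet2 f p := (continuousOn_jet2 hU hf).restrict
  have hJg : Continuous fun p : U ↦ jet2 g p := (continuousOn_jet2 hU hg).restrict
  -- the clamped segment, continuous on `U × ℝ` with values in `Γ`
  set F : U → ℝ → (Jet n →L[ℝ] ℝ) := fun p t ↦
    fderiv ℝ Φ (jet2 f p + (max 0 (min t 1)) • (jet2 g p - jet2 f p)) with hF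
  have hclamp : ∀ t : ℝ, max 0 (min t 1) ∈ Icc (0 : ℝ) 1 := fun t ↦
    ⟨le_max_left _ _, max_le zero_le_one (min_le_right _ _)⟩
  have hpath : Continuous fun q : U × ℝ ↦
      jet2 f q.1 + (max 0 (min q.2 1)) • (jet2 g q.1 - jet2 f q.1) := by
    have h1 : Continuous fun q : U × ℝ ↦ jet2 f q.1 := hJf.comp continuous_fst
    have h2 : Continuous fun q : U × ℝ ↦ jet2 g q.1 := hJg.comp continuous_fst
    have h3 : Continuous fun q : U × ℝ ↦ max 0 (min q.2 1) := by fun_prop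
    exact h1.add (h3.smul (h2.sub h1))
  have hFc : Continuous (uncurry F) := by
    refine (hΦ.continuousOn_fderiv_of_isOpen hΓ le_rfl).comp_continuous hpath fun q ↦ ?_
    rw [← jet2_segment hU hf hg q.1.2]
    exact hseg _ (hclamp q.2) _ q.1.2
  have hcont := intervalIntegral.continuous_parametric_intervalIntegral_of_continuous'
    (μ := volume) hFc 0 1
  refine hcont.congr fun p ↦ integral_congr fun t ht ↦ ?_
  rw [uIcc_of_le zero_le_one] at ht
  have : max 0 (min t 1) = t := by
    rw [min_eq_left ht.2, max_eq_right ht.1]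
  simp only [hF, this]

end Linearisation

/-! ### Algebraic lemmas on coefficient arrays -/

section Algebra

/-- Symmetrising the coefficients does not change the contraction with a symmetric array.
[folklore] -/
theorem sum_symmetrize_mul_eq {a H : Fin n → Fin n → ℝ} (hH : ∀ i j, H i j = H j i) :
    ∑ i, ∑ j, (a i j + a j i) / 2 * H i j = ∑ i, ∑ j, a i j * H i j := by
  have h1 : ∑ i, ∑ j, (a i j + a j i) / 2 * H i j =
      (∑ i, ∑ j, a i j * H i j) / 2 + (∑ i, ∑ j, a j i * H i j) / 2 := by
    rw [Finset.sum_div, Finset.sum_div, ← Finset.sum_add_distrib]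
    refine Finset.sum_congr rfl fun i _ ↦ ?_
    rw [Finset.sum_div, Finset.sum_div, ← Finset.sum_add_distrib]
    refine Finset.sum_congr rfl fun j _ ↦ ?_
    ring
  have h2 : ∑ i, ∑ j, a j i * H i j = ∑ i, ∑ j, a i j * H i j := by
    rw [Finset.sum_comm]
    exact Finset.sum_congr rfl fun i _ ↦ Finset.sum_congr rfl fun j _ ↦ by rw [hH j i]
  rw [h1, h2]
  ring

/-- Homogeneity of the quadratic form of a coefficient array. [folklore] -/
theorem sum_mul_smul_smul (a : Fin n → Fin n → ℝ) (s : ℝ) (η : Fin n → ℝ) :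
    ∑ i, ∑ j, a i j * (s * η i) * (s * η j) = s ^ 2 * ∑ i, ∑ j, a i j * η i * η j := by
  rw [Finset.mul_sum]
  refine Finset.sum_congr rfl fun i _ ↦ ?_
  rw [Finset.mul_sum]
  refine Finset.sum_congr rfl fun j _ ↦ ?_
  ring

/-- A single entry is bounded by the sum of the absolute values of all entries. [folklore] -/
theorem abs_le_sum_sum_abs (a : Fin n → Fin n → ℝ) (i j : Fin n) :
    |a i j| ≤ ∑ i', ∑ j', |a i' j'| := by
  calc |a i j| ≤ ∑ j', |a i j'| :=
        Finset.single_le_sum (f := fun j' ↦ |a i j'|) (fun _ _ ↦ abs_nonneg _) (Finset.mem_univ j)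
    _ ≤ ∑ i', ∑ j', |a i' j'| :=
        Finset.single_le_sum (f := fun i' ↦ ∑ j', |a i' j'|)
          (fun _ _ ↦ Finset.sum_nonneg fun _ _ ↦ abs_nonneg _) (Finset.mem_univ i)

/-- A single entry is bounded by the sum of the absolute values of all entries. [folklore] -/
theorem abs_le_sum_abs (b : Fin n → ℝ) (i : Fin n) : |b i| ≤ ∑ i', |b i'| :=
  Finset.single_le_sum (f := fun i' ↦ |b i'|) (fun _ _ ↦ abs_nonneg _) (Finset.mem_univ i)

end Algebra

/-! ### Alexandrov's maximum principle -/

section Alexandrov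

variable {Φ : Jet n → ℝ} {Γ : Set (Jet n)}

/-- **Alexandrov's maximum principle for `C¹` elliptic operators on jets** (Fontenele–Silva,
Illinois J. Math. 45 (2001), §2, "Maximum Principle", after A. D. Alexandrov): every `Φ` of
class `C¹` on an open set `Γ` of jets has the tangency maximum principle on `Γ`
(`HasTangencyMaximumPrinciple Φ Γ`): *if `f ≤ g` are `C²` on an open `U ⊆ ℝⁿ`, the jets of
`(1 - t) f + t g`, `t ∈ [0, 1]`, lie in `Γ` where `Φ` is elliptic, and `Φ(Λf) ≥ Φ(Λg)` on `U`,
then `f = g` near every point `x₀ ∈ U` with `f(x₀) = g(x₀)`.* Proof as printed: by the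
fundamental theorem of calculus along the segment of jets,
`0 ≥ Φ(Λg) - Φ(Λf) = L(g - f) := ∑ aᵢⱼ ∂ᵢⱼ(g - f) + ∑ bᵢ ∂ᵢ(g - f) + c (g - f)` with continuous
coefficients `aᵢⱼ = ∫₀¹ ∂Φ/∂rᵢⱼ`, `bᵢ = ∫₀¹ ∂Φ/∂rᵢ`, `c = ∫₀¹ ∂Φ/∂z` along the segment,
`(aᵢⱼ)` positive definite by ellipticity; on a small closed ball around `x₀` the symmetrised
operator is uniformly elliptic with bounded coefficients, and `w = g - f ≥ 0`, `w(x₀) = 0` is a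
superharmonic function of `𝔏 = -∑ ãᵢⱼ ∂ᵢⱼ - ∑ bᵢ ∂ᵢ + c⁻` (`𝔏w = -L w + c⁺ w ≥ 0`), so `w ≡ 0`
near `x₀` by E. Hopf's minimum principle (`hopf_minimumPrinciple_eventually_eq`,
López-Gómez 2012, Thm. 1.2). [cite: FonteneleSilva2001, §2 Maximum Principle]
[cite: LopezGomez2012, Thm. 1.2] -/
theorem hasTangencyMaximumPrinciple_of_contDiffOn (hΓ : IsOpen Γ) (hΦ : ContDiffOn ℝ 1 Φ Γ) :
    HasTangencyMaximumPrinciple Φ Γ := by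
  intro U f g hU hf hg hseg hΦle hfg x₀ hx₀ hfx₀
  -- coordinate jets, the averaged derivative `A` and the coefficients `a, b, c`
  set E2 : Fin n → Fin n → Jet n := fun i j ↦
    ((Pi.single i (Pi.single j (1 : ℝ)) : Fin n → Fin n → ℝ), (0 : Fin n → ℝ), (0 : ℝ),
      (0 : EuclideanSpace ℝ (Fin n))) with hE2
  set E1 : Fin n → Jet n := fun i ↦
    ((0 : Fin n → Fin n → ℝ), (Pi.single i (1 : ℝ) : Fin n → ℝ), (0 : ℝ),
      (0 : EuclideanSpace ℝ (Fin n))) with hE1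
  set E0 : Jet n := ((0 : Fin n → Fin n → ℝ), (0 : Fin n → ℝ), (1 : ℝ),
    (0 : EuclideanSpace ℝ (Fin n))) with hE0
  set A : EuclideanSpace ℝ (Fin n) → (Jet n →L[ℝ] ℝ) := fun x ↦
    ∫ t in (0 : ℝ)..1, fderiv ℝ Φ (jet2 f x + t • (jet2 g x - jet2 f x)) with hA
  set a : EuclideanSpace ℝ (Fin n) → Fin n → Fin n → ℝ := fun x i j ↦ A x (E2 i j) with ha
  set b : EuclideanSpace ℝ (Fin n) → Fin n → ℝ := fun x i ↦ A x (E1 i) with hb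
  set c : EuclideanSpace ℝ (Fin n) → ℝ := fun x ↦ A x E0 with hc
  have hsegx : ∀ x ∈ U, ∀ t ∈ Icc (0 : ℝ) 1, jet2 ((1 - t) • f + t • g) x ∈ Γ :=
    fun x hx t ht ↦ (hseg t ht x hx).1
  -- (1) linearisation: `L(g - f) = Φ(Λg) - Φ(Λf)` on `U`
  have hlin : ∀ x ∈ U, ∑ i, ∑ j, a x i j * (jet2 g x - jet2 f x).1 i j +
      ∑ i, b x i * (jet2 g x - jet2 f x).2.1 i + c x * (jet2 g x - jet2 f x).2.2.1 =
      Φ (jet2 g x) - Φ (jet2 f x) := by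
    intro x hx
    rw [sub_eq_integral_fderiv_jetSegment hΓ hΦ hU hf hg hx (hsegx x hx)]
    change _ = A x (jet2 g x - jet2 f x)
    rw [clm_jet_apply_eq_sum (A x) _ (by simp)]
    simp only [ha, hb, hc, hE2, hE1, hE0]
    congr 1
    · congr 1
      · exact Finset.sum_congr rfl fun i _ ↦ Finset.sum_congr rfl fun j _ ↦ mul_comm _ _
      · exact Finset.sum_congr rfl fun i _ ↦ mul_comm _ _
    · exact mul_comm _ _
  -- (2) pointwise ellipticity of `(aᵢⱼ)`
  have hellpt : ∀ x ∈ U, ∀ ξ : Fin n → ℝ, ξ ≠ 0 → 0 < ∑ i, ∑ j, a x i j * ξ i * ξ j := by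
    intro x hx ξ hξ
    have hq : ∑ i, ∑ j, a x i j * ξ i * ξ j = A x ((fun i j ↦ ξ i * ξ j), 0, 0, 0) := by
      rw [clm_quadJet_eq_sum (A x) ξ]
    rw [hq]
    change 0 < (∫ t in (0 : ℝ)..1, fderiv ℝ Φ (jet2 f x + t • (jet2 g x - jet2 f x)))
      ((fun i j ↦ ξ i * ξ j), 0, 0, 0)
    rw [ContinuousLinearMap.intervalIntegral_apply
      (intervalIntegrable_fderiv_comp_jetSegment hΓ hΦ hU hf hg hx (hsegx x hx))]
    refine intervalIntegral_pos_of_pos_on ?_ (fun t ht ↦ ?_) zero_lt_one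
    · refine ContinuousOn.intervalIntegrable ?_
      rw [uIcc_of_le zero_le_one]
      exact (continuousOn_fderiv_comp_jetSegment hΓ hΦ hU hf hg hx (hsegx x hx)).clm_apply
        continuousOn_const
    · have := (hseg t (Ioo_subset_Icc_self ht) x hx).2 ξ hξ
      rwa [jet2_segment hU hf hg hx] at this
  -- (3) continuity of the coefficients on `U`
  have hAc : ContinuousOn A U := continuousOn_integral_fderiv_jetSegment hΓ hΦ hU hf hg
    fun t ht x hx ↦ (hseg t ht x hx).1
  have hac : ∀ i j, ContinuousOn (fun x ↦ a x i j) U := fun i j ↦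
    hAc.clm_apply continuousOn_const
  have hbc : ∀ i, ContinuousOn (fun x ↦ b x i) U := fun i ↦ hAc.clm_apply continuousOn_const
  have hcc : ContinuousOn c U := hAc.clm_apply continuousOn_const
  -- (4) a closed ball `K ⊆ U` around `x₀`; bounds and uniform ellipticity on `K`
  obtain ⟨r, hr, hrU⟩ := nhds_basis_closedBall.mem_iff.mp (hU.mem_nhds hx₀)
  set K : Set (EuclideanSpace ℝ (Fin n)) := closedBall x₀ r with hK
  have hKc : IsCompact K := isCompact_closedBall _ _
  have hS : ContinuousOn (fun x ↦ ∑ i, ∑ j, |a x i j| + ∑ i, |b x i| + |c x|) K := by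
    refine ((continuousOn_finsetSum _ fun i _ ↦ continuousOn_finsetSum _ fun j _ ↦
      continuous_abs.comp_continuousOn ((hac i j).mono hrU)).add
      (continuousOn_finsetSum _ fun i _ ↦
        continuous_abs.comp_continuousOn ((hbc i).mono hrU))).add
      (continuous_abs.comp_continuousOn (hcc.mono hrU))
  obtain ⟨C, hC⟩ := hKc.exists_bound_of_continuousOn hS
  have hbdK : ∀ x ∈ K, (∀ i j, |a x i j| ≤ C) ∧ (∀ i, |b x i| ≤ C) ∧ |c x| ≤ C := by
    intro x hx
    have h := (le_abs_self _).trans (Real.norm_eq_abs _ ▸ hC x hx)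
    have h1 : 0 ≤ ∑ i, ∑ j, |a x i j| :=
      Finset.sum_nonneg fun _ _ ↦ Finset.sum_nonneg fun _ _ ↦ abs_nonneg _
    have h2 : 0 ≤ ∑ i, |b x i| := Finset.sum_nonneg fun _ _ ↦ abs_nonneg _
    have h3 := abs_nonneg (c x)
    exact ⟨fun i j ↦ by linarith [abs_le_sum_sum_abs (a x) i j],
      fun i ↦ by linarith [abs_le_sum_abs (b x) i], by linarith⟩
  obtain ⟨μ, hμ, hellK⟩ : ∃ μ : ℝ, 0 < μ ∧ ∀ x ∈ K, ∀ ξ : EuclideanSpace ℝ (Fin n),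
      μ * ‖ξ‖ ^ 2 ≤ ∑ i, ∑ j, a x i j * ξ i * ξ j := by
    set Q : EuclideanSpace ℝ (Fin n) × EuclideanSpace ℝ (Fin n) → ℝ := fun p ↦
      ∑ i, ∑ j, a p.1 i j * p.2 i * p.2 j with hQ
    by_cases hne : (K ×ˢ sphere (0 : EuclideanSpace ℝ (Fin n)) 1).Nonempty
    · have hQc : ContinuousOn Q (K ×ˢ sphere 0 1) := by
        refine continuousOn_finsetSum _ fun i _ ↦ continuousOn_finsetSum _ fun j _ ↦ ?_
        have h1 : ContinuousOn (fun p : EuclideanSpace ℝ (Fin n) × EuclideanSpace ℝ (Fin n) ↦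
            a p.1 i j) (K ×ˢ sphere 0 1) :=
          (hac i j).comp continuousOn_fst fun p hp ↦ hrU hp.1
        have h2 : ∀ k, Continuous fun p : EuclideanSpace ℝ (Fin n) × EuclideanSpace ℝ (Fin n) ↦
            p.2 k := fun k ↦ by fun_prop
        exact (h1.mul (h2 i).continuousOn).mul (h2 j).continuousOn
      obtain ⟨p₀, hp₀, hminQ⟩ := (hKc.prod (isCompact_sphere 0 1)).exists_isMinOn hne hQc
      have hp₀2 : p₀.2 ≠ 0 := by
        intro h
        have := mem_sphere_zero_iff_norm.mp hp₀.2
        rw [h, norm_zero] at this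
        exact zero_ne_one this
      have hp₀2' : (p₀.2 : Fin n → ℝ) ≠ 0 := fun h ↦ hp₀2 (by
        simpa using congrArg (WithLp.toLp 2) h)
      refine ⟨Q p₀, hellpt p₀.1 (hrU hp₀.1) _ hp₀2', fun x hx ξ ↦ ?_⟩
      by_cases hξ : ξ = 0
      · subst hξ; simp
      · have hnξ : 0 < ‖ξ‖ := norm_pos_iff.mpr hξ
        set η : EuclideanSpace ℝ (Fin n) := ‖ξ‖⁻¹ • ξ with hη
        have hηS : η ∈ sphere (0 : EuclideanSpace ℝ (Fin n)) 1 := by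
          rw [mem_sphere_zero_iff_norm, hη, norm_smul, norm_inv, norm_norm,
            inv_mul_cancel₀ hnξ.ne']
        have hmin : Q p₀ ≤ Q (x, η) := hminQ ⟨hx, hηS⟩
        have hQη : Q (x, η) = ‖ξ‖⁻¹ ^ 2 * ∑ i, ∑ j, a x i j * ξ i * ξ j := by
          simp only [hQ, hη, PiLp.smul_apply, smul_eq_mul]
          exact sum_mul_smul_smul _ _ _
        rw [hQη] at hmin
        have h2 : Q p₀ * ‖ξ‖ ^ 2 ≤ ‖ξ‖⁻¹ ^ 2 * (∑ i, ∑ j, a x i j * ξ i * ξ j) * ‖ξ‖ ^ 2 :=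
          mul_le_mul_of_nonneg_right hmin (by positivity)
        calc Q p₀ * ‖ξ‖ ^ 2 ≤ ‖ξ‖⁻¹ ^ 2 * (∑ i, ∑ j, a x i j * ξ i * ξ j) * ‖ξ‖ ^ 2 := h2
          _ = ∑ i, ∑ j, a x i j * ξ i * ξ j := by field_simp
    · refine ⟨1, one_pos, fun x hx ξ ↦ ?_⟩
      have hξ : ξ = 0 := by
        by_contra hξ
        have hnξ : 0 < ‖ξ‖ := norm_pos_iff.mpr hξ
        refine hne ⟨(x, ‖ξ‖⁻¹ • ξ), hx, ?_⟩
        rw [mem_sphere_zero_iff_norm, norm_smul, norm_inv, norm_norm, inv_mul_cancel₀ hnξ.ne']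
      subst hξ; simp
  -- (5) the symmetrised operator `𝔏 = -∑ ãᵢⱼ∂ᵢⱼ - ∑ bᵢ∂ᵢ + c⁻` and E. Hopf's minimum principle
  set w : EuclideanSpace ℝ (Fin n) → ℝ := fun x ↦ g x - f x with hw
  have hbU : ball x₀ r ⊆ U := ball_subset_closedBall.trans hrU
  have hwC2 : ContDiffOn ℝ 2 w (ball x₀ r) := (hg.sub hf).mono hbU
  have hLw : ∀ x ∈ ball x₀ r, 0 ≤
      -(∑ i, ∑ j, (a x i j + a x j i) / 2 * fderiv ℝ (fderiv ℝ w) x (EuclideanSpace.single i 1)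
        (EuclideanSpace.single j 1)) +
      ∑ i, -(b x i) * fderiv ℝ w x (EuclideanSpace.single i 1) + max (-(c x)) 0 * w x := by
    intro x hx
    have hxU : x ∈ U := hbU hx
    have hwx : ContDiffAt ℝ 2 w x := hwC2.contDiffAt (isOpen_ball.mem_nhds hx)
    have hsym : ∀ i j, fderiv ℝ (fderiv ℝ w) x (EuclideanSpace.single i 1)
        (EuclideanSpace.single j 1) = fderiv ℝ (fderiv ℝ w) x (EuclideanSpace.single j 1)
        (EuclideanSpace.single i 1) := fun i j ↦ hwx.isSymmSndFDerivAt (by simp) _ _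
    rw [sum_symmetrize_mul_eq hsym]
    have h1 : ∀ i j, (jet2 g x - jet2 f x).1 i j = fderiv ℝ (fderiv ℝ w) x
        (EuclideanSpace.single i 1) (EuclideanSpace.single j 1) :=
      fun i j ↦ (jet2_sub_eq hU hf hg hxU i j).1
    have h2 : ∀ i, (jet2 g x - jet2 f x).2.1 i = fderiv ℝ w x (EuclideanSpace.single i 1) :=
      fun i ↦ (jet2_sub_eq hU hf hg hxU i i).2.1
    have h3 : (jet2 g x - jet2 f x).2.2.1 = w x := by simp [hw]
    have hL := hlin x hxU
    simp only [h1, h2, h3] at hL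
    have hle : Φ (jet2 g x) ≤ Φ (jet2 f x) := hΦle x hxU
    have hwnn : 0 ≤ w x := sub_nonneg.mpr (hfg x hxU)
    have hcm : 0 ≤ c x * w x + max (-(c x)) 0 * w x := by
      rw [← add_mul]
      refine mul_nonneg ?_ hwnn
      rcases le_total 0 (c x) with h | h
      · rw [max_eq_right (by linarith)]; linarith
      · rw [max_eq_left (by linarith)]; linarith
    have hneg : ∑ i, -(b x i) * fderiv ℝ w x (EuclideanSpace.single i 1) =
        -(∑ i, b x i * fderiv ℝ w x (EuclideanSpace.single i 1)) := by
      rw [← Finset.sum_neg_distrib]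
      exact Finset.sum_congr rfl fun i _ ↦ neg_mul _ _
    rw [hneg]
    linarith
  have key := hopf_minimumPrinciple_eventually_eq (Ω := ball x₀ r) isOpen_ball
    (a := fun x i j ↦ (a x i j + a x j i) / 2) (b := fun x i ↦ -(b x i))
    (c := fun x ↦ max (-(c x)) 0) (u := w) (μ := μ) (m := 0)
    (fun x _ i j ↦ by rw [add_comm]) hμ
    (fun x hx ξ ↦ by
      have h := hellK x (ball_subset_closedBall hx) ξ
      simp only [mul_assoc] at h ⊢
      rwa [sum_symmetrize_mul_eq (fun i j ↦ mul_comm _ _)])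
    (fun K' hK' _ ↦ ⟨C, fun x hx ↦ by
      obtain ⟨hCa, hCb, hCc⟩ := hbdK x (ball_subset_closedBall (hK' hx))
      refine ⟨fun i j ↦ ?_, fun i ↦ ?_, ?_⟩
      · rw [abs_div, abs_two]
        linarith [abs_add_le (a x i j) (a x j i), hCa i j, hCa j i]
      · rw [abs_neg]; exact hCb i
      · rw [abs_of_nonneg (le_max_right _ _)]
        exact (max_le (neg_le_abs _) (abs_nonneg _)).trans hCc⟩)
    (fun x _ ↦ le_max_right _ _) hwC2 hLw le_rfl
    (fun x hx ↦ sub_nonneg.mpr (hfg x (hbU hx))) (mem_ball_self hr) (by simp [hw, hfx₀])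
  filter_upwards [key] with x hx
  have : g x - f x = 0 := hx
  linarith

/-! ### Consequences for minimal graphs and the barrier principle -/

/-- **The maximum principle for minimal graphs from the minimal-graph operators alone.** With
Alexandrov's maximum principle proved (`hasTangencyMaximumPrinciple_of_contDiffOn`), the
reduction `minimalGraph_strongMaximumPrinciple_of_graphOperator` of `MinimalSurfaceTangency.lean`
needs only step (2): a minimal-graph operator `MinimalGraphOperator h ψ T` (Fontenele–Silva 2001,
Lemma 3.1, Props. 3.2, 3.4: the mean curvature of a chart-graph is a `C¹` elliptic function of
the jet of the graph function, vanishing on minimal graphs) for every chart of every Riemannian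
`3`-manifold. [cite: FonteneleSilva2001, §2 Maximum Principle and proof of Thm. 1.1]
[cite: AnderssonGallowayHoward1998, Thm. 3.10] -/
theorem minimalGraph_strongMaximumPrinciple_of_minimalGraphOperator
    (H : ∀ (X : Type) [TopologicalSpace X] [ChartedSpace E3 X] [IsManifold (𝓡 3) ∞ X] [T2Space X]
      [SecondCountableTopology X]
      (h : ContMDiffRiemannianMetric (𝓡 3) ∞ E3 (TangentSpace (𝓡 3) : X → Type _))
      [(ofRiemannian h).HasLeviCivita]
      (ψ : OpenPartialHomeomorph X E3) (T : E3 ≃L[ℝ] EuclideanSpace ℝ (Fin 2) × ℝ),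
      ψ ∈ IsManifold.maximalAtlas (𝓡 3) ∞ X → Nonempty (MinimalGraphOperator h ψ T)) :
    minimalGraph_strongMaximumPrinciple :=
  minimalGraph_strongMaximumPrinciple_of_graphOperator fun X _ _ _ _ _ h _ ψ T hψ ↦ by
    obtain ⟨G⟩ := H X h ψ T hψ
    exact ⟨G, hasTangencyMaximumPrinciple_of_contDiffOn (isOpen_chartJetSet ψ T) G.contDiffOn⟩

/-- **The barrier principle for minimal surfaces from the minimal-graph operators alone**
(`minimalSurface_barrierPrinciple_of_graph` with the previous theorem and the discharged
`touchingSurface_locallyGraph_holds`). [cite: Eschenburg1989, Thm. 1]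
[cite: AnderssonGallowayHoward1998, Thm. 3.10] -/
theorem minimalSurface_barrierPrinciple_of_minimalGraphOperator
    (H : ∀ (X : Type) [TopologicalSpace X] [ChartedSpace E3 X] [IsManifold (𝓡 3) ∞ X] [T2Space X]
      [SecondCountableTopology X]
      (h : ContMDiffRiemannianMetric (𝓡 3) ∞ E3 (TangentSpace (𝓡 3) : X → Type _))
      [(ofRiemannian h).HasLeviCivita]
      (ψ : OpenPartialHomeomorph X E3) (T : E3 ≃L[ℝ] EuclideanSpace ℝ (Fin 2) × ℝ),
      ψ ∈ IsManifold.maximalAtlas (𝓡 3) ∞ X → Nonempty (MinimalGraphOperator h ψ T)) :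
    minimalSurface_barrierPrinciple :=
  minimalSurface_barrierPrinciple_of_graph
    (minimalGraph_strongMaximumPrinciple_of_minimalGraphOperator H)
    touchingSurface_locallyGraph_holds

/-- **gr.S09, connected horizon**, from Huisken–Ilmanen's two facts and the minimal-graph
operators alone (`riemannian_penrose_inequality_connected_smooth_of_graph` with the maximum
principle for minimal graphs discharged up to step (2)).
[cite: HuiskenIlmanenIMCF2001, Main Theorem, Lemma 4.1 and §8 step 1] -/
theorem riemannian_penrose_inequality_connected_smooth_of_minimalGraphOperator
    (h1 : exteriorRegion_structure) (h2 : riemannian_penrose_inequality_exteriorRegion)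
    (H : ∀ (X : Type) [TopologicalSpace X] [ChartedSpace E3 X] [IsManifold (𝓡 3) ∞ X] [T2Space X]
      [SecondCountableTopology X]
      (h : ContMDiffRiemannianMetric (𝓡 3) ∞ E3 (TangentSpace (𝓡 3) : X → Type _))
      [(ofRiemannian h).HasLeviCivita]
      (ψ : OpenPartialHomeomorph X E3) (T : E3 ≃L[ℝ] EuclideanSpace ℝ (Fin 2) × ℝ),
      ψ ∈ IsManifold.maximalAtlas (𝓡 3) ∞ X → Nonempty (MinimalGraphOperator h ψ T)) :
    riemannian_penrose_inequality_connected_smooth :=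
  riemannian_penrose_inequality_connected_smooth_of_graph h1 h2
    (minimalGraph_strongMaximumPrinciple_of_minimalGraphOperator H)
    touchingSurface_locallyGraph_holds

end Alexandrov

end Literature.Geometry.Lorentzian

end
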